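import Summits.Langlands.Langlands.Theorems.IrreducibilityBySelfDualityIrreducibleOffSectorIotaTransport
import Mathlib.FieldTheory.Minpoly.Field
import Mathlib.Algebra.Algebra.Hom.Rat
import HarnessLib

/-!
# `IrreducibleOffSector`: for L-arithmetic `π`, FINITELY many `ι` decide the crux at each `ℓ`
(crux stmt-Langlands-14329 `IrreducibilityBySelfDuality.IrreducibleOffSector`, line `Sketch`;
`--supports` file, STRUCTURAL: no import of the route module; continuation lead c5)

Sequel of `…IrreducibleOffSectorIotaTransport` (p123746).  There, (B) `conclusion_of_conclusion_of_eqOn`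
showed that for `π` L-arithmetic over a subfield `E ⊆ ℂ` a.e. the crux's conclusion
`C(ι) :≡ ∀ ρ, (∀ᶠ v, SatakeFrobCompatibleAt ι π ρ v) → ρ irreducible` depends on `ι : ℚ̄_ℓ ≃+* ℂ`
only through the embedding `ι⁻¹|_E : E → ℚ̄_ℓ`.  When `E` is finite over `ℚ` (a number field, as in
Buzzard–Gee Def. 3.1.4 / Clozel's Hecke field) there are only finitely many such embeddings —
Mathlib `AlgHom.fintype : Fintype (E →ₐ[ℚ] ℚ̄_ℓ)` (at most `[E:ℚ]` of them) — so:

* `exists_finite_iota_representatives` — there is a FINITE set `S` of isomorphisms `ℚ̄_ℓ ≃+* ℂ`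
  such that every `ι` agrees on `E` with some `ι₁ ∈ S`;
* `conclusion_forall_of_conclusion_finite` — hence the conclusion at the finitely many `ι₁ ∈ S`
  gives it at EVERY `ι`: the uncountable `∀ ι` of the crux is, for L-arithmetic `π`, a finite
  conjunction at each prime `ℓ` (unconditionally; no valuation theory — compare the sequel
  `…IotaTransportPlaces`, which identifies the classes with the primes `λ ∣ ℓ` of `E`);
* `irreducibleOffSector_conclusion_finite_of_isLArithmetic` — binder shape.

References: K. Buzzard, T. Gee, LMS LNS 414 (2014), Def. 3.1.4, Conj. 3.1.6, Conj. 3.2.1;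
J. Neukirch, *Algebraic Number Theory* (1999), Ch. II (8.1)–(8.2).
-/

noncomputable section

set_option linter.dupNamespace false

open scoped NumberField Classical Polynomial
open Filter IsDedekindDomain
open Literature.NumberTheory.Automorphic Literature.NumberTheory.GaloisRepresentations
open Summit.Langlands

namespace Summit.Langlands.Langlands.Theorems.IrreducibleOffSector

section Finite

variable {ℓ : ℕ} [Fact ℓ.Prime]

/-- **Finitely many `ι` up to their restriction to a number field.**  For a subfield `E ⊆ ℂ` finite
over `ℚ` there is a finite set `S` of isomorphisms `ℚ̄_ℓ ≃+* ℂ` such that every `ι : ℚ̄_ℓ ≃+* ℂ`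
agrees on `E` with some `ι₁ ∈ S` (`ι⁻¹ x = ι₁⁻¹ x` for `x ∈ E`): the restrictions `ι⁻¹|_E` range
over the finite set `E →ₐ[ℚ] ℚ̄_ℓ` (Mathlib `AlgHom.fintype`), and `S` picks one `ι` per attained
restriction. [cite: NeukirchANT1999, Ch. II (8.1)–(8.2)] -/
theorem exists_finite_iota_representatives (E : Subfield ℂ) [FiniteDimensional ℚ E] :
    ∃ S : Set (PadicAlgCl ℓ ≃+* ℂ), S.Finite ∧
      ∀ ι : PadicAlgCl ℓ ≃+* ℂ, ∃ ι₁ ∈ S, ∀ x ∈ E, ι.symm x = ι₁.symm x := by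
  -- the restriction `ι ↦ ι⁻¹|_E` to the finite type `E →ₐ[ℚ] ℚ̄_ℓ`
  let r : (PadicAlgCl ℓ ≃+* ℂ) → (E →ₐ[ℚ] PadicAlgCl ℓ) := fun ι =>
    ((ι.symm : ℂ ≃+* PadicAlgCl ℓ).toRingHom.comp E.subtype).toRatAlgHom
  have hr : ∀ (ι : PadicAlgCl ℓ ≃+* ℂ) (x : E), r ι x = ι.symm x := fun ι x => by
    simp [r, RingHom.toRatAlgHom_apply]
  let sec : Set.range r → (PadicAlgCl ℓ ≃+* ℂ) := fun φ => φ.2.choose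
  have hsec : ∀ φ : Set.range r, r (sec φ) = φ.1 := fun φ => φ.2.choose_spec
  refine ⟨Set.range sec, Set.finite_range sec, fun ι => ?_⟩
  refine ⟨sec ⟨r ι, ι, rfl⟩, Set.mem_range_self _, fun x hx => ?_⟩
  have h := congrArg (fun φ : E →ₐ[ℚ] PadicAlgCl ℓ => φ ⟨x, hx⟩) (hsec ⟨r ι, ι, rfl⟩)
  simp only [hr] at h
  exact h.symm

variable {K : Type} [Field K] [NumberField K] {n : ℕ} {hcpt : isCompact_glFiniteIntegralLevel n K}

/-- **Finitely many `ι` decide the crux's conclusion at `ℓ`, for L-arithmetic `π`.**  Let `π` be an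
automorphic datum on `GL_n(𝔸_K)` whose unramified Hecke eigenvalues `e_i(t_{π,v})`, `i ≤ n`, lie in
a subfield `E ⊆ ℂ` finite over `ℚ` at almost all places.  Then there is a FINITE set `S` of
isomorphisms `ℚ̄_ℓ ≃+* ℂ` such that: if every `ρ` Satake–Frobenius compatible with `(π, ι₁)` a.e.
is irreducible for each `ι₁ ∈ S`, then the same holds for EVERY `ι : ℚ̄_ℓ ≃+* ℂ`
(`exists_finite_iota_representatives` + the L-arithmetic transport `conclusion_of_conclusion_of_eqOn`).
[cite: BuzzardGeeLMS2014, Def. 3.1.4 and Conj. 3.2.1] -/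
theorem conclusion_forall_of_conclusion_finite (E : Subfield ℂ) [FiniteDimensional ℚ E]
    (π : AutomorphicRepData (AutomorphyDatum.gl n K hcpt))
    (hE : ∀ᶠ v : HeightOneSpectrum (𝓞 K) in cofinite, ∀ α : Multiset ℂ, π.HasSatakeParamAt v α →
      ∀ i ≤ n, α.esymm i ∈ E) :
    ∃ S : Set (PadicAlgCl ℓ ≃+* ℂ), S.Finite ∧
      ((∀ ι₁ ∈ S, ∀ ρ : FramedGaloisRep K (PadicAlgCl ℓ) n,
          (∀ᶠ v : HeightOneSpectrum (𝓞 K) in cofinite, SatakeFrobCompatibleAt ι₁ π ρ v) →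
            ρ.toGaloisRep.IsIrreducible) →
        ∀ (ι : PadicAlgCl ℓ ≃+* ℂ) (ρ : FramedGaloisRep K (PadicAlgCl ℓ) n),
          (∀ᶠ v : HeightOneSpectrum (𝓞 K) in cofinite, SatakeFrobCompatibleAt ι π ρ v) →
            ρ.toGaloisRep.IsIrreducible) := by
  obtain ⟨S, hS, hrep⟩ := exists_finite_iota_representatives (ℓ := ℓ) E
  refine ⟨S, hS, fun h ι ρ hρ => ?_⟩
  obtain ⟨ι₁, hι₁, heq⟩ := hrep ι
  exact conclusion_of_conclusion_of_eqOn ι₁ ι E (fun x hx => (heq x hx).symm) π hE (h ι₁ hι₁) ρ hρ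

end Finite

/-! ## In the binder shape of the crux -/

/-- **For L-arithmetic `π` the crux's `∀ ι` is a FINITE conjunction at each `ℓ`** (binder shape of
`IrreducibleOffSector`): for `n, K, hcpt`, a cuspidal `π` L-arithmetic over a subfield `E ⊆ ℂ`
finite over `ℚ` at almost all places, and `ℓ`, there is a finite set `S` of isomorphisms
`ℚ̄_ℓ ≃+* ℂ` such that the conclusion of `IrreducibleOffSector` at every `ι₁ ∈ S` implies it at EVERY
`ι`. [cite: BuzzardGeeLMS2014, Conj. 3.1.6 and Conj. 3.2.1] -/
theorem irreducibleOffSector_conclusion_finite_of_isLArithmetic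
    (n : ℕ) (K : Type) [Field K] [NumberField K] (hcpt : isCompact_glFiniteIntegralLevel n K)
    (π : CuspidalAutomorphicRepData n K hcpt) (E : Subfield ℂ) (hfd : FiniteDimensional ℚ E)
    (hE : ∀ᶠ v : HeightOneSpectrum (𝓞 K) in cofinite, ∀ α : Multiset ℂ, π.1.HasSatakeParamAt v α →
      ∀ i ≤ n, α.esymm i ∈ E)
    (ℓ : ℕ) [Fact ℓ.Prime] :
    ∃ S : Set (PadicAlgCl ℓ ≃+* ℂ), S.Finite ∧
      ((∀ ι₁ ∈ S, ∀ ρ : FramedGaloisRep K (PadicAlgCl ℓ) n,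
          (∀ᶠ v : HeightOneSpectrum (𝓞 K) in cofinite, SatakeFrobCompatibleAt ι₁ π.1 ρ v) →
            ρ.toGaloisRep.IsIrreducible) →
        ∀ (ι : PadicAlgCl ℓ ≃+* ℂ) (ρ : FramedGaloisRep K (PadicAlgCl ℓ) n),
          (∀ᶠ v : HeightOneSpectrum (𝓞 K) in cofinite, SatakeFrobCompatibleAt ι π.1 ρ v) →
            ρ.toGaloisRep.IsIrreducible) := by
  haveI := hfd
  exact conclusion_forall_of_conclusion_finite E π.1 hE

end Summit.Langlands.Langlands.Theorems.IrreducibleOffSector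

end
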